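import Summits.Langlands.Langlands.Theses.SmithKummerSeed
import Summits.Langlands.Langlands.Theorems.IrreducibilityBySelfDualityReciprocityUpToIrreducibilityCorrespondsConj

/-!
# Birth skeleton (BC3) for crux stmt-Langlands-18645
`Summit.Langlands.Langlands.Theses.SmithKummerSeed.CyclicPrimeDescent` — line `birth`

Route `route-Langlands-SmithKummerSeed`; the crux is piece 2 of the crux-strategist split of
`AscentConjugationSolvable` (stmt-Langlands-1094; assembly proved in `Cruxes/AscentConjugationSolvable/Split.lean`):
for a Galois extension of number fields `L/K` of PRIME degree, full reciprocity for `GL_n` over `L` implies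
full reciprocity over `K`.  This is where the parent's open core lives.

This file concludes the crux BY NAME from two named stubs, cut along the DIRECTION seam, sharing the
reciprocity data:

* `stub_descentAutToGal` (load-bearing; THE OPEN CORE of the conjugation-solvable ascent) — direction (A) over
  `K` from reciprocity over `L`; it PRODUCES the data `R` for `K`: for `π` cuspidal L-algebraic over `K` the
  cyclic base change `BC(π)` (tree: `exists_baseChange_cyclic`; Arthur–Clozel Ch. 3 Thm 4.2) is an isobaric sum
  of cuspidals over `L` whose Galois representation (reciprocity over `L`) is `σ`-invariant and extends to
  `Γ_K` (irreducible case: `p` extensions differing by the characters `η^j` of `Gal(L/K)`; Clifford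
  bookkeeping otherwise); ONE extension must match `π` at the INERT places — where base change sees only
  `p`-th powers of the Satake parameters — and carry local–global compatibility at every place: solvable
  NON-NORMAL base change (`K` need not be Galois over anything), known for `n = 1` (class field theory) and for
  the non-normal cubic lift on `GL_2` (Jacquet–Piatetski-Shapiro–Shalika 1981, converse theorem); Lapid 1998
  §1 ("we only have the constructions for normal subgroups"); Rajan 2002 (image and fibres of solvable base
  change);
* `stub_descentWeakGalToAut` (M–L, theorem-level) — WEAK direction (B) over `K` (a.e. Satake matching) for the
  same `R`, from reciprocity over `L` and (A) over `K`: `ρ|_{Γ_L}` irreducible ⇒ automorphic `Π` over `L` by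
  (B) over `L`, `Π^σ ≅ Π` (strong multiplicity one), `Π = BC(π₀)` by Arthur–Clozel cyclic descent (tree:
  `ArthurClozel1989_cuspidal_descent`), `ρ ≅ ρ_{π₀ ⊗ η^j}` for some `j` by (A) over `K` + Chebotarev /
  Brauer–Nesbitt over `L` + Clifford; `ρ|_{Γ_L}` reducible ⇒ `ρ ≅ Ind τ`, `π_τ` by (B) over `L`, `AI(π_τ)`
  cuspidal over `K` (tree: `automorphicInduction_cyclic_cuspidal`), `ρ ≅ ρ_{AI(π_τ) ⊗ η^j}` likewise — the
  printed argument of BLGGT §5 / CHT §4 for one cyclic layer (pattern: `LiftDescend.SolvableDescentOfAutomorphy`).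

The composition `CyclicPrimeDescent_of` is kernel-checked and sorry-free and is not a one-line seam: it takes
`R` from stub 1, weak (B) for that `R` from stub 2, and UPGRADES weak (B) to the summit's `GaloisToAutomorphic`
by the LANDED Chebotarev–Brauer–Nesbitt transport
`Theorems.ReciprocityUpToIrreducibility.corresponds_of_exists_corresponds` — packaged as the sorry-free lemma
`galoisToAutomorphic_of_weak` (verbatim the body of item stmt-Langlands-1065 `LiftDescend.WeakToStrongGalToAut`).

Shape (for `ledger skeleton check`): each stub is `theorem stub_<name> : <Prop> := by sorry`;
`_Goal.stub_<name> : Prop := type_of% @stub_<name>`;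
`CyclicPrimeDescent_of (h₁ : _Goal.stub_descentAutToGal) (h₂ : _Goal.stub_descentWeakGalToAut) : CyclicPrimeDescent`
concludes the route decl BY NAME; the last `example` feeds the stubs to it.

Disproof used: none exists (crux born 2026-08-17; `ledger crux ls stmt-Langlands-1094`: `Split.lean` only); the
crux is a consequence of the summit (`fun hS K L … => hS K`), so no `_false_without_H` with `H` short of
`¬Langlands` can exist; `SolvableImageBarrierNarrow`'s recorded gap (non-normal layers) IS stub 1, not
evaded. BC3 probes (stub → crux, stub → summit): failed 6/6 (strategist folder bc/CyclicPrimeDescent_stub_probes.lean,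
rc 1). Sources: [ArthurClozelAMS120] Ch. 3 Thms 4.2/6.2 and closing remark, [JPSS1981Cubique], [Lapid1998] §1,
Rajan 2002 (doi:10.4310/mrl.2002.v9.n4.a9), [BarnetlambEtAl2014] §5, [Clifford1937].
-/

set_option linter.dupNamespace false

noncomputable section

namespace Summit.Langlands.Langlands.Cruxes.CyclicPrimeDescent.Birth

open Summit.Langlands.Langlands.Theses.SmithKummerSeed
open Filter

/-! ## 1. The two stubs -/

/-- **STUB 1 — direction (A) descends along a Galois layer of prime degree** (load-bearing, the open core).
For `L/K` Galois of prime degree and full reciprocity over `L`, there are reciprocity data `R` for `K` such that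
every L-algebraic cuspidal `π` of `GL_n(𝔸_K)`, `n ≥ 1`, has for all `ℓ`, `ι` an irreducible geometric `ρ_{π,ι}`
corresponding to it at every finite place, unique up to conjugacy — the descent of `ρ_{BC(π)}` with the twist
fixed at the inert places (solvable non-normal base change). Why it might fail short of the summit: at inert
places `BC(π)` pins only `p`-th powers of Satake parameters, and patching over auxiliary cyclic `K·M/K` is
circular. [cite: ArthurClozelAMS120, Ch. 3 Thm. 4.2] [cite: JPSS1981Cubique, Théorème] [cite: Lapid1998, §1] -/
theorem stub_descentAutToGal : ∀ (K L : Type) [Field K] [NumberField K] [Field L] [NumberField L] [Algebra K L] [IsGalois K L], (Module.finrank K L).Prime → (∃ R : ReciprocityData L, ∀ n : ℕ, 0 < n → ∀ hcpt : Literature.NumberTheory.Automorphic.isCompact_glFiniteIntegralLevel n L, GlobalLanglandsCorrespondenceGLn n L R hcpt) → ∃ R : ReciprocityData K, ∀ n : ℕ, 0 < n → ∀ hcpt : Literature.NumberTheory.Automorphic.isCompact_glFiniteIntegralLevel n K, AutomorphicToGalois n R hcpt := by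
  sorry

/-- **STUB 2 — weak direction (B) over `K`, given reciprocity over `L` and (A) over `K` for the same data**:
for `L/K` Galois of prime degree, reciprocity data `R` for `K` carrying direction (A) in every rank, and full
reciprocity over `L`, every irreducible `R`-geometric `ρ : Γ_K → GL_n(ℚ̄_ℓ)` is Satake–Frobenius compatible at
almost all places with some L-algebraic cuspidal `π` of `GL_n(𝔸_K)` (automorphy of `ρ|_{Γ_L}` or of its
Clifford constituent over `L`, Arthur–Clozel cyclic descent / automorphic induction, identification through
(A) over `K`). Local–global compatibility is NOT asked here: it is recovered in `galoisToAutomorphic_of_weak`.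
[cite: ArthurClozelAMS120, Ch. 3 Thm. 4.2 and Thm. 6.2] [cite: Clifford1937, Thm. 1] -/
theorem stub_descentWeakGalToAut : ∀ (K L : Type) [Field K] [NumberField K] [Field L] [NumberField L] [Algebra K L] [IsGalois K L] (R : ReciprocityData K), (Module.finrank K L).Prime → (∃ R₁ : ReciprocityData L, ∀ n : ℕ, 0 < n → ∀ hcpt : Literature.NumberTheory.Automorphic.isCompact_glFiniteIntegralLevel n L, GlobalLanglandsCorrespondenceGLn n L R₁ hcpt) → (∀ n : ℕ, 0 < n → ∀ hcpt : Literature.NumberTheory.Automorphic.isCompact_glFiniteIntegralLevel n K, AutomorphicToGalois n R hcpt) → ∀ (n : ℕ), 0 < n → ∀ (ℓ : ℕ) [Fact ℓ.Prime] (ι : PadicAlgCl ℓ ≃+* ℂ) (ρ : Literature.NumberTheory.GaloisRepresentations.FramedGaloisRep K (PadicAlgCl ℓ) n), ρ.toGaloisRep.IsIrreducible → IsGeometricFramed R ρ → ∀ hcpt : Literature.NumberTheory.Automorphic.isCompact_glFiniteIntegralLevel n K, ∃ π : Literature.NumberTheory.Automorphic.CuspidalAutomorphicRepData n K hcpt,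 π.1.IsLAlgebraic ∧ ∀ᶠ v : IsDedekindDomain.HeightOneSpectrum (NumberField.RingOfIntegers K) in cofinite, SatakeFrobCompatibleAt ι π.1 ρ v := by
  sorry

/-! ## 2. The stub statements as named propositions (the composition's hypotheses, by name) -/

namespace _Goal

/-- The statement of `stub_descentAutToGal`, as a named `Prop` (literally its type). [folklore] -/
def stub_descentAutToGal : Prop :=
  type_of% @Summit.Langlands.Langlands.Cruxes.CyclicPrimeDescent.Birth.stub_descentAutToGal

/-- The statement of `stub_descentWeakGalToAut`, as a named `Prop` (literally its type). [folklore] -/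
def stub_descentWeakGalToAut : Prop :=
  type_of% @Summit.Langlands.Langlands.Cruxes.CyclicPrimeDescent.Birth.stub_descentWeakGalToAut

end _Goal

/-! ## 3. Weak ⇒ strong (B), a theorem of the tree (Chebotarev + Brauer–Nesbitt transport) -/

/-- **Weak-to-strong upgrade of direction (B), for the same reciprocity data** (verbatim the body of item
stmt-Langlands-1065 `LiftDescend.WeakToStrongGalToAut`, here PROVED, as in `Cruxes/ReciprocityTRCM/Lines/birth.lean`):
(A) for `𝓡` in every rank + a.e. Satake matching of every irreducible geometric `ρ` ⇒ (B) for `𝓡`, by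
`corresponds_of_exists_corresponds` (landed, sorry-free).
[cite: DeligneSerreASENS1974, Lemme 3.2] [cite: BuzzardGeeLMS2014, Conj. 3.2.2] -/
theorem galoisToAutomorphic_of_weak (F : Type) [Field F] [NumberField F] (R : ReciprocityData F)
    (hA : ∀ n : ℕ, 0 < n →
      ∀ hcpt : Literature.NumberTheory.Automorphic.isCompact_glFiniteIntegralLevel n F,
        AutomorphicToGalois n R hcpt)
    (hW : ∀ (n : ℕ), 0 < n → ∀ (ℓ : ℕ) [Fact ℓ.Prime] (ι : PadicAlgCl ℓ ≃+* ℂ)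
      (ρ : Literature.NumberTheory.GaloisRepresentations.FramedGaloisRep F (PadicAlgCl ℓ) n),
      ρ.toGaloisRep.IsIrreducible → IsGeometricFramed R ρ →
        ∀ hcpt : Literature.NumberTheory.Automorphic.isCompact_glFiniteIntegralLevel n F,
          ∃ π : Literature.NumberTheory.Automorphic.CuspidalAutomorphicRepData n F hcpt,
            π.1.IsLAlgebraic ∧
              ∀ᶠ v : IsDedekindDomain.HeightOneSpectrum (NumberField.RingOfIntegers F) in cofinite,
                SatakeFrobCompatibleAt ι π.1 ρ v) :
    ∀ n : ℕ, 0 < n →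
      ∀ hcpt : Literature.NumberTheory.Automorphic.isCompact_glFiniteIntegralLevel n F,
        GaloisToAutomorphic n R hcpt := by
  intro n hn hcpt ℓ _ ι ρ hirr hgeo
  obtain ⟨π, hL, hsat⟩ := hW n hn ℓ ι ρ hirr hgeo hcpt
  obtain ⟨ρ', -, -, hcorr', -⟩ := hA n hn hcpt π hL ℓ ι
  exact ⟨π, hL,
    Theorems.ReciprocityUpToIrreducibility.corresponds_of_exists_corresponds hirr hsat ⟨ρ', hcorr'⟩⟩

/-! ## 4. The composition (kernel-checked, no `sorry`): (A)_K with its data → weak (B)_K → crux by name -/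

/-- **`CyclicPrimeDescent` from the two stubs.** Given `L/K` Galois of prime degree and reciprocity over `L`:
`R` and (A) over `K` from stub 1; weak (B) for that `R` from stub 2; (B) with local–global compatibility
everywhere by `galoisToAutomorphic_of_weak`; so `GlobalLanglandsCorrespondenceGLn n K R hcpt = (A) ∧ (B)` for
every `n ≥ 1`. The hypotheses are, by name, the statements of `stub_descentAutToGal`, `stub_descentWeakGalToAut`;
the conclusion is the route decl. [folklore] -/
theorem CyclicPrimeDescent_of (h₁ : _Goal.stub_descentAutToGal) (h₂ : _Goal.stub_descentWeakGalToAut) :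
    CyclicPrimeDescent := by
  unfold _Goal.stub_descentAutToGal at h₁
  unfold _Goal.stub_descentWeakGalToAut at h₂
  intro K L _ _ _ _ _ _ hp hL
  obtain ⟨R, hAR⟩ := h₁ K L hp hL
  exact ⟨R, fun n hn hcpt =>
    ⟨hAR n hn hcpt, galoisToAutomorphic_of_weak K R hAR (h₂ K L R hp hL hAR) n hn hcpt⟩⟩

/-- By-name sanity check (an `example`, not a declaration of the file): the two stubs feed the composition
as they stand. -/
example : CyclicPrimeDescent := CyclicPrimeDescent_of stub_descentAutToGal stub_descentWeakGalToAut

end Summit.Langlands.Langlands.Cruxes.CyclicPrimeDescent.Birth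

end
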